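import Literature.Analysis.FluidPDE.PassiveVectorTensorGalerkinSmooth
import Literature.Analysis.FluidPDE.PassiveVectorGalerkinLimit
import Literature.Analysis.FluidPDE.NSHopfWeakConvergence
import HarnessLib

/-!
# The Fourier–Galerkin scheme with a smooth carrier, III: truncation, uniform bounds, diagonal extraction,
  the limit field

Analysis/FluidPDE proof-support file (definitions with bodies + theorems; no named facts). Sequel of
`PassiveVectorTensorGalerkinSmooth`, ported from the scalar-viscosity chain `PassiveVectorGalerkinLimit` (Hopf's
compactness method; Robinson–Rodrigo–Sadowski 2016, Thm. 4.4 Step 3 and Thm. 4.11) with two changes: the viscous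
term is the constant tensor `𝔸` (`NearIso 𝔸 lo hi`, `lo ≥ 0`) and the carrier is a SMOOTH field
(`Torus.SmoothCarrier b M G`) entering through the exact transport coefficient — there is no Bloch sector and no
mean-zero constraint (the phase space is `galerkinSubspace (freqBall N)`).

* §1 `PVSSetup 𝔸 lo hi b M G w₀` (the data), the Galerkin approximations `PVSSetup.galerkinCoeff N` (solutions of
  the truncated system on `freqBall N` from `P_N w₀`, `exists_pvsGalerkin_solution`), the uniform energy bound
  `∑_k ‖α_N t k‖² ≤ ∫‖w₀‖²` and the monotonicity of the energy;
* §2 the equi-Lipschitz estimate of every mode (`pvsModeLip`; the transport part by the `N`-uniform bound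
  `norm_pvsConvCoeff_le_of_energy`);
* §3 the diagonal extraction `exists_subseq_tendsto_galerkinCoeffAt` (every mode converges at every `t ≥ 0`);
* §4 the limit field and the package `PVSSetup.IsGalerkinLimit` (with `𝓕(w t) = c t` for every `t ≥ 0`).

## References

* E. Hopf, Math. Nachr. 4 (1951) 213–231, §4. [`Hopf1951`]
* J. C. Robinson, J. L. Rodrigo, W. Sadowski, *The three-dimensional Navier–Stokes equations* (CUP 2016), Thm. 4.4
  Step 3, Thm. 4.11, Exercises 4.2–4.9. [`RobinsonRodrigoSadowski2016`]
-/

open MeasureTheory Set Filter Topology UnitAddTorus Metric Function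
open scoped ENNReal NNReal InnerProductSpace

noncomputable section

namespace Literature.Analysis.FluidPDE

namespace Torus

open FunctionSpaces.Torus FunctionSpaces

variable {d : Type*} [Fintype d] [DecidableEq d]

/-! ## §0 Standing hypotheses -/

section Setup

/-- **The data of the smooth-carrier scheme**: a constant tensor in a Legendre–Hadamard window `NearIso 𝔸 lo hi` with
`lo ≥ 0`, a smooth carrier `SmoothCarrier b M G`, and a weakly divergence-free datum `w₀ ∈ L²(T^d; ℝ^d)`.
[cite: RobinsonRodrigoSadowski2016, Thm. 4.4] -/
structure PVSSetup (𝔸 : Visc4 d) (lo hi : ℝ) (b : ℝ → UnitAddTorus d → EuclideanSpace ℝ d) (M G : ℝ)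
    (w₀ : UnitAddTorus d → EuclideanSpace ℝ d) : Prop where
  nearIso : NearIso 𝔸 lo hi
  lo_nonneg : 0 ≤ lo
  carrier : SmoothCarrier b M G
  memLp : MemLp w₀ 2 volume
  divFree : FunctionSpaces.Torus.IsWeaklyDivFree w₀

end Setup

/-! ## §1 The Galerkin approximations of order `N` -/

section Scheme

variable {𝔸 : Visc4 d} {lo hi : ℝ} {b : ℝ → UnitAddTorus d → EuclideanSpace ℝ d} {M G : ℝ}
  {w₀ : UnitAddTorus d → EuclideanSpace ℝ d}

/-- **The truncated datum lies in the Galerkin phase space** (real, transversal). [cite: ConstantinFoias1988, Ch. 8 (8.3)–(8.5)] -/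
theorem datumTrunc_mem_galerkinSubspace (h : PVSSetup 𝔸 lo hi b M G w₀) (N : ℕ) :
    datumTrunc w₀ N ∈ galerkinSubspace (freqBall N) :=
  ⟨isRealCoeff_mFourierCoeff (h.memLp.integrable one_le_two),
    isSolenoidalCoeff_restrict (h.divFree.isTransversal_mFourierCoeff h.memLp (freqBall N))⟩

/-- **The Galerkin coefficient curve of order `N`**: the solution of the truncated system on `freqBall N` from the
truncated datum, valued in the Galerkin phase space, with non-increasing energy (chosen by
`exists_pvsGalerkin_solution`). [cite: RobinsonRodrigoSadowski2016, Thm. 4.4 Steps 1–2] -/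
def PVSSetup.galerkinCoeff (h : PVSSetup 𝔸 lo hi b M G w₀) (N : ℕ) : ℝ → ↥(freqBall (d := d) N) → EuclideanSpace ℂ d :=
  (exists_pvsGalerkin_solution h.nearIso h.lo_nonneg (neg_mem_freqBall_of_mem (N := N)) h.carrier
    (datumTrunc_mem_galerkinSubspace h N)).choose

/-- The defining properties of the Galerkin coefficient curve. [cite: RobinsonRodrigoSadowski2016, Thm. 4.4 Steps 1–2] -/
theorem PVSSetup.galerkinCoeff_spec (h : PVSSetup 𝔸 lo hi b M G w₀) (N : ℕ) :
    h.galerkinCoeff N 0 = datumTrunc w₀ N ∧ (∀ t, h.galerkinCoeff N t ∈ galerkinSubspace (freqBall N)) ∧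
      ContinuousOn (h.galerkinCoeff N) (Ici 0) ∧
      (∀ T, ∀ t ∈ Icc 0 T, HasDerivWithinAt (h.galerkinCoeff N)
        (pvsRHS (freqBall N) 𝔸 (b t) (h.galerkinCoeff N t)) (Icc 0 T) t) ∧
      ∀ t₁ t, 0 ≤ t₁ → t₁ ≤ t → ∑ k, ‖h.galerkinCoeff N t k‖ ^ 2 ≤ ∑ k, ‖h.galerkinCoeff N t₁ k‖ ^ 2 :=
  (exists_pvsGalerkin_solution h.nearIso h.lo_nonneg (neg_mem_freqBall_of_mem (N := N)) h.carrier
    (datumTrunc_mem_galerkinSubspace h N)).choose_spec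

/-- **Uniform coefficient-energy bound**: `∑_k ‖α_N t k‖² ≤ ∫‖w₀‖²` for `t ≥ 0`. [cite: RobinsonRodrigoSadowski2016, Thm. 4.4 Step 2 (4.8)] -/
theorem PVSSetup.sum_norm_sq_galerkinCoeff_le (h : PVSSetup 𝔸 lo hi b M G w₀) (N : ℕ) {t : ℝ} (ht : 0 ≤ t) :
    ∑ k, ‖h.galerkinCoeff N t k‖ ^ 2 ≤ ∫ x, ‖w₀ x‖ ^ 2 := by
  have h1 := (h.galerkinCoeff_spec N).2.2.2.2 0 t le_rfl ht
  rw [(h.galerkinCoeff_spec N).1] at h1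
  exact h1.trans (sum_norm_sq_datumTrunc_le h.memLp N)

/-- Per-mode bound: `‖α_N t k‖ ≤ (∫‖w₀‖²)^{1/2}`. [cite: RobinsonRodrigoSadowski2016, Thm. 4.4 Step 2 (4.8)] -/
theorem PVSSetup.norm_galerkinCoeff_le (h : PVSSetup 𝔸 lo hi b M G w₀) (N : ℕ) {t : ℝ} (ht : 0 ≤ t)
    (k : ↥(freqBall (d := d) N)) : ‖h.galerkinCoeff N t k‖ ≤ Real.sqrt (∫ x, ‖w₀ x‖ ^ 2) := by
  refine Real.le_sqrt_of_sq_le ?_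
  exact (Finset.single_le_sum (f := fun k => ‖h.galerkinCoeff N t k‖ ^ 2) (fun k _ => sq_nonneg _)
    (Finset.mem_univ k)).trans (h.sum_norm_sq_galerkinCoeff_le N ht)

/-- Sup-norm bound of the state: `‖α_N t‖ ≤ (∫‖w₀‖²)^{1/2}`. [cite: RobinsonRodrigoSadowski2016, Thm. 4.4 Step 2 (4.8)] -/
theorem PVSSetup.norm_galerkinCoeff_le' (h : PVSSetup 𝔸 lo hi b M G w₀) (N : ℕ) {t : ℝ} (ht : 0 ≤ t) :
    ‖h.galerkinCoeff N t‖ ≤ Real.sqrt (∫ x, ‖w₀ x‖ ^ 2) :=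
  (pi_norm_le_iff_of_nonneg (Real.sqrt_nonneg _)).2 fun k => h.norm_galerkinCoeff_le N ht k

/-- **The Fourier coefficients of the approximations**, extended by zero off the ball. [cite: RobinsonRodrigoSadowski2016, Thm. 4.11] -/
def PVSSetup.galerkinCoeffAt (h : PVSSetup 𝔸 lo hi b M G w₀) (N : ℕ) (t : ℝ) (k : d → ℤ) : EuclideanSpace ℂ d :=
  coeffExt (freqBall N) (h.galerkinCoeff N t) k

/-- **The Galerkin approximation of order `N`**: `u_N(t) = realTrigPoly (freqBall N) (α_N t)`. [cite: RobinsonRodrigoSadowski2016, Thm. 4.4 Step 1 (4.3)] -/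
def PVSSetup.galerkinApprox (h : PVSSetup 𝔸 lo hi b M G w₀) (N : ℕ) (t : ℝ) : UnitAddTorus d → EuclideanSpace ℝ d :=
  realTrigPoly (freqBall N) (h.galerkinCoeffAt N t)

/-- Unfolding of `galerkinApprox`. [cite: RobinsonRodrigoSadowski2016, Thm. 4.4 Step 1 (4.3)] -/
theorem PVSSetup.galerkinApprox_def (h : PVSSetup 𝔸 lo hi b M G w₀) (N : ℕ) (t : ℝ) :
    h.galerkinApprox N t = realTrigPoly (freqBall N) (coeffExt (freqBall N) (h.galerkinCoeff N t)) := rfl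

/-- The extended coefficients are conjugate symmetric. [cite: ConstantinFoias1988, Ch. 8 (8.3)–(8.5)] -/
theorem PVSSetup.isConjSymm_galerkinCoeffAt (h : PVSSetup 𝔸 lo hi b M G w₀) (N : ℕ) (t : ℝ) :
    IsConjSymm (h.galerkinCoeffAt N t) :=
  ((h.galerkinCoeff_spec N).2.1 t).1.isConjSymm_coeffExt neg_mem_freqBall_of_mem

/-- The extended coefficients are transversal everywhere. [cite: ConstantinFoias1988, Ch. 8 (8.3)–(8.5)] -/
theorem PVSSetup.sum_mul_galerkinCoeffAt (h : PVSSetup 𝔸 lo hi b M G w₀) (N : ℕ) (t : ℝ) (k : d → ℤ) :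
    ∑ j, (k j : ℂ) * h.galerkinCoeffAt N t k j = 0 := by
  by_cases hk : k ∈ freqBall N
  · rw [PVSSetup.galerkinCoeffAt, coeffExt_of_mem _ hk]
    exact ((h.galerkinCoeff_spec N).2.1 t).2 ⟨k, hk⟩
  · rw [PVSSetup.galerkinCoeffAt, coeffExt_of_not_mem _ hk]; simp

/-- `galerkinCoeffAt` is the Fourier coefficient family of the approximation. [cite: Grafakos2014, Prop. 3.2.7 (3)] -/
theorem PVSSetup.mFourierCoeff_galerkinApprox (h : PVSSetup 𝔸 lo hi b M G w₀) (N : ℕ) (t : ℝ) (k : d → ℤ) :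
    mFourierCoeff (EuclideanSpace.complexify ∘ h.galerkinApprox N t) k = h.galerkinCoeffAt N t k := by
  rw [PVSSetup.galerkinApprox, mFourierCoeff_realTrigPoly neg_mem_freqBall_of_mem (h.isConjSymm_galerkinCoeffAt N t)]
  by_cases hk : k ∈ freqBall N
  · rw [if_pos hk]
  · rw [if_neg hk, PVSSetup.galerkinCoeffAt, coeffExt_of_not_mem _ hk]

/-- **Uniform bound**: `‖α_N(t)(k)‖ ≤ (∫‖w₀‖²)^{1/2}` for `t ≥ 0`, every `k`. [cite: RobinsonRodrigoSadowski2016, Thm. 4.4 Step 2 (4.8)] -/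
theorem PVSSetup.norm_galerkinCoeffAt_le (h : PVSSetup 𝔸 lo hi b M G w₀) (N : ℕ) {t : ℝ} (ht : 0 ≤ t) (k : d → ℤ) :
    ‖h.galerkinCoeffAt N t k‖ ≤ Real.sqrt (∫ x, ‖w₀ x‖ ^ 2) :=
  (norm_coeffExt_le _ k).trans (h.norm_galerkinCoeff_le' N ht)

/-- **Finite energy bounds**: for every finite `F ⊆ ℤ^d` and `t ≥ 0`, `∑_{k∈F} ‖α_N(t)(k)‖² ≤ ∑_k ‖α_N(t) k‖²`.
[cite: RobinsonRodrigoSadowski2016, Thm. 4.4 Step 2 (4.8)] -/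
theorem PVSSetup.sum_norm_sq_galerkinCoeffAt_le_sum (h : PVSSetup 𝔸 lo hi b M G w₀) (N : ℕ) (t : ℝ) (F : Finset (d → ℤ)) :
    ∑ k ∈ F, ‖h.galerkinCoeffAt N t k‖ ^ 2 ≤ ∑ k, ‖h.galerkinCoeff N t k‖ ^ 2 := by
  classical
  have hsplit : ∑ k ∈ F, ‖h.galerkinCoeffAt N t k‖ ^ 2 = ∑ k ∈ F ∩ freqBall N, ‖h.galerkinCoeffAt N t k‖ ^ 2 := by
    refine (Finset.sum_subset Finset.inter_subset_left fun k hkF hk => ?_).symm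
    have hkS : k ∉ freqBall N := fun hkS => hk (Finset.mem_inter.2 ⟨hkF, hkS⟩)
    rw [PVSSetup.galerkinCoeffAt, coeffExt_of_not_mem _ hkS]; simp
  rw [hsplit]
  calc ∑ k ∈ F ∩ freqBall N, ‖h.galerkinCoeffAt N t k‖ ^ 2
      ≤ ∑ k ∈ freqBall N, ‖h.galerkinCoeffAt N t k‖ ^ 2 :=
        Finset.sum_le_sum_of_subset_of_nonneg Finset.inter_subset_right fun k _ _ => sq_nonneg _
    _ = ∑ k, ‖h.galerkinCoeff N t k‖ ^ 2 := by
        rw [← Finset.sum_coe_sort]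
        exact Finset.sum_congr rfl fun k _ => by rw [PVSSetup.galerkinCoeffAt, coeffExt_coe]

/-- `∑_{k∈F} ‖α_N(t)(k)‖² ≤ ∫‖w₀‖²` for `t ≥ 0`. [cite: RobinsonRodrigoSadowski2016, Thm. 4.4 Step 2 (4.8)] -/
theorem PVSSetup.sum_norm_sq_galerkinCoeffAt_le (h : PVSSetup 𝔸 lo hi b M G w₀) (N : ℕ) {t : ℝ} (ht : 0 ≤ t)
    (F : Finset (d → ℤ)) : ∑ k ∈ F, ‖h.galerkinCoeffAt N t k‖ ^ 2 ≤ ∫ x, ‖w₀ x‖ ^ 2 :=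
  (h.sum_norm_sq_galerkinCoeffAt_le_sum N t F).trans (h.sum_norm_sq_galerkinCoeff_le N ht)

/-- `∫‖u_N(t)‖² = ∑_k ‖α_N t k‖²` (Parseval). [cite: Grafakos2014, Prop. 3.2.7 (3)] -/
theorem PVSSetup.integral_norm_sq_galerkinApprox (h : PVSSetup 𝔸 lo hi b M G w₀) (N : ℕ) (t : ℝ) :
    ∫ x, ‖h.galerkinApprox N t x‖ ^ 2 = ∑ k, ‖h.galerkinCoeff N t k‖ ^ 2 := by
  rw [PVSSetup.galerkinApprox, integral_norm_sq_realTrigPoly neg_mem_freqBall_of_mem (h.isConjSymm_galerkinCoeffAt N t),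
    ← Finset.sum_coe_sort]
  exact Finset.sum_congr rfl fun k _ => by rw [PVSSetup.galerkinCoeffAt, coeffExt_coe]

/-- `∫‖u_N(t)‖² ≤ ∫‖w₀‖²` for `t ≥ 0`. [cite: RobinsonRodrigoSadowski2016, Thm. 4.4 Step 2 (4.8)] -/
theorem PVSSetup.integral_norm_sq_galerkinApprox_le (h : PVSSetup 𝔸 lo hi b M G w₀) (N : ℕ) {t : ℝ} (ht : 0 ≤ t) :
    ∫ x, ‖h.galerkinApprox N t x‖ ^ 2 ≤ ∫ x, ‖w₀ x‖ ^ 2 := by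
  rw [h.integral_norm_sq_galerkinApprox N t]
  exact h.sum_norm_sq_galerkinCoeff_le N ht

end Scheme

/-! ## §2 Equi-Lipschitz estimate for the Fourier modes -/

section Equicontinuity

variable {𝔸 : Visc4 d} {lo hi : ℝ} {b : ℝ → UnitAddTorus d → EuclideanSpace ℝ d} {M G : ℝ}
  {w₀ : UnitAddTorus d → EuclideanSpace ℝ d}

/-- The equi-Lipschitz constant of the `k`-th mode: `(4π²‖T_𝔸(k)‖ + M · 2π ∑_j |k_j|) (∫‖w₀‖²)^{1/2}`.
[cite: RobinsonRodrigoSadowski2016, Ex. 4.2] -/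
def pvsModeLip (𝔸 : Visc4 d) (M : ℝ) (w₀ : UnitAddTorus d → EuclideanSpace ℝ d) (k : d → ℤ) : ℝ :=
  (4 * Real.pi ^ 2 * ‖symbTL 𝔸 k‖ + M * (2 * Real.pi * ∑ j, |(k j : ℝ)|)) * Real.sqrt (∫ x, ‖w₀ x‖ ^ 2)

omit [DecidableEq d] in
/-- The equi-Lipschitz constant is nonnegative for `M ≥ 0`. [cite: RobinsonRodrigoSadowski2016, Ex. 4.2] -/
theorem pvsModeLip_nonneg (𝔸 : Visc4 d) {M : ℝ} (hM : 0 ≤ M) (w₀ : UnitAddTorus d → EuclideanSpace ℝ d) (k : d → ℤ) :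
    0 ≤ pvsModeLip 𝔸 M w₀ k := by
  unfold pvsModeLip; positivity

/-- **Uniform bound on the time derivative of each mode**: for `t ≥ 0` and `k ∈ freqBall N`,
`‖V(b(t), α_N(t))_k‖ ≤ pvsModeLip 𝔸 M w₀ k`. [cite: RobinsonRodrigoSadowski2016, Ex. 4.2] -/
theorem PVSSetup.norm_rhs_galerkinCoeff_le (h : PVSSetup 𝔸 lo hi b M G w₀) (N : ℕ) {t : ℝ} (ht : 0 ≤ t)
    (k : ↥(freqBall (d := d) N)) :
    ‖pvsRHS (freqBall N) 𝔸 (b t) (h.galerkinCoeff N t) k‖ ≤ pvsModeLip 𝔸 M w₀ (k : d → ℤ) := by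
  have hM := h.carrier.nonneg
  have hE0 : 0 ≤ Real.sqrt (∫ x, ‖w₀ x‖ ^ 2) := Real.sqrt_nonneg _
  rw [pvsRHS_apply, pvsField_def]
  refine (norm_sub_le _ _).trans ?_
  have h1 : ‖-(((4 * Real.pi ^ 2 : ℝ) : ℂ) • leraySym (k : d → ℤ) (symbT 𝔸 k (coeffExt (freqBall N) (h.galerkinCoeff N t) k)))‖ ≤
      4 * Real.pi ^ 2 * ‖symbTL 𝔸 k‖ * Real.sqrt (∫ x, ‖w₀ x‖ ^ 2) := by
    rw [norm_neg, norm_smul, Complex.norm_real, Real.norm_of_nonneg (by positivity : (0:ℝ) ≤ 4 * Real.pi ^ 2)]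
    have hx : ‖coeffExt (freqBall N) (h.galerkinCoeff N t) k‖ ≤ Real.sqrt (∫ x, ‖w₀ x‖ ^ 2) :=
      (norm_coeffExt_le (h.galerkinCoeff N t) (k : d → ℤ)).trans (h.norm_galerkinCoeff_le' N ht)
    have hT : ‖leraySym (k : d → ℤ) (symbT 𝔸 k (coeffExt (freqBall N) (h.galerkinCoeff N t) k))‖ ≤
        ‖symbTL 𝔸 k‖ * Real.sqrt (∫ x, ‖w₀ x‖ ^ 2) :=
      (norm_leraySym_le (k : d → ℤ) _).trans ((norm_symbT_le_opNorm 𝔸 k _).trans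
        (mul_le_mul_of_nonneg_left hx (norm_nonneg _)))
    calc 4 * Real.pi ^ 2 * ‖leraySym (k : d → ℤ) (symbT 𝔸 k (coeffExt (freqBall N) (h.galerkinCoeff N t) k))‖
        ≤ 4 * Real.pi ^ 2 * (‖symbTL 𝔸 k‖ * Real.sqrt (∫ x, ‖w₀ x‖ ^ 2)) := mul_le_mul_of_nonneg_left hT (by positivity)
      _ = _ := by ring
  have h2 : ‖leraySym (k : d → ℤ) (pvsConvCoeff (freqBall N) (b t) (coeffExt (freqBall N) (h.galerkinCoeff N t)) k)‖ ≤
      M * (2 * Real.pi * ∑ j, |((k : d → ℤ) j : ℝ)|) * Real.sqrt (∫ x, ‖w₀ x‖ ^ 2) := by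
    refine (norm_leraySym_le (k : d → ℤ) _).trans ?_
    refine (norm_pvsConvCoeff_le_of_energy (h.carrier.smooth t) (h.carrier.divFree t) hM (h.carrier.norm_le t) _ _).trans ?_
    refine mul_le_mul_of_nonneg_left (Real.sqrt_le_sqrt ?_) (by positivity)
    have := h.integral_norm_sq_galerkinApprox_le N ht
    rwa [PVSSetup.galerkinApprox_def] at this
  calc _ ≤ 4 * Real.pi ^ 2 * ‖symbTL 𝔸 k‖ * Real.sqrt (∫ x, ‖w₀ x‖ ^ 2) +
        M * (2 * Real.pi * ∑ j, |((k : d → ℤ) j : ℝ)|) * Real.sqrt (∫ x, ‖w₀ x‖ ^ 2) := add_le_add h1 h2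
    _ = pvsModeLip 𝔸 M w₀ (k : d → ℤ) := by rw [pvsModeLip]; ring

/-- **Equi-Lipschitz bound for the Galerkin modes** (mean value inequality): for `k ∈ freqBall N` and
`s, t ∈ [0, T]`, `‖α_N(t)_k − α_N(s)_k‖ ≤ pvsModeLip 𝔸 M w₀ k · |t − s|`. [cite: RobinsonRodrigoSadowski2016, Ex. 4.2] -/
theorem PVSSetup.norm_galerkinCoeff_sub_le (h : PVSSetup 𝔸 lo hi b M G w₀) (N : ℕ) {T s t : ℝ}
    (hs : s ∈ Icc 0 T) (ht : t ∈ Icc 0 T) (k : ↥(freqBall (d := d) N)) :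
    ‖h.galerkinCoeff N t k - h.galerkinCoeff N s k‖ ≤ pvsModeLip 𝔸 M w₀ (k : d → ℤ) * |t - s| := by
  obtain ⟨-, -, -, hsol, -⟩ := h.galerkinCoeff_spec N
  have hk : ∀ τ ∈ Icc 0 T, HasDerivWithinAt (fun τ => h.galerkinCoeff N τ k)
      (pvsRHS (freqBall N) 𝔸 (b τ) (h.galerkinCoeff N τ) k) (Icc 0 T) τ := fun τ hτ =>
    (ContinuousLinearMap.proj (R := ℝ) (φ := fun _ : ↥(freqBall (d := d) N) => EuclideanSpace ℂ d) k).hasFDerivAt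
      |>.comp_hasDerivWithinAt τ (hsol T τ hτ)
  have hmv := Convex.norm_image_sub_le_of_norm_hasDerivWithin_le hk
    (fun τ hτ => h.norm_rhs_galerkinCoeff_le N hτ.1 k) (convex_Icc 0 T) hs ht
  rwa [Real.norm_eq_abs] at hmv

end Equicontinuity

/-! ## §3 Diagonal extraction -/

section Extraction

variable {𝔸 : Visc4 d} {lo hi : ℝ} {b : ℝ → UnitAddTorus d → EuclideanSpace ℝ d} {M G : ℝ}
  {w₀ : UnitAddTorus d → EuclideanSpace ℝ d}

/-- **Diagonal extraction.** Along a subsequence `φ`, the Fourier modes `α_{φ n}(t)(k)` of the Galerkin approximations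
converge for every frequency `k` and every time `t ≥ 0` (countably many bounded sequences at the nonnegative rational
times, Tychonoff; then all times by the equi-Lipschitz estimate), to limits `c t k` inheriting the finite energy
bounds, the Lipschitz continuity in time, conjugate symmetry and transversality. [cite: RobinsonRodrigoSadowski2016, Thm. 4.11] -/
theorem PVSSetup.exists_subseq_tendsto_galerkinCoeffAt (h : PVSSetup 𝔸 lo hi b M G w₀) :
    ∃ φ : ℕ → ℕ, StrictMono φ ∧ ∃ c : ℝ → (d → ℤ) → EuclideanSpace ℂ d,
      (∀ t, 0 ≤ t → ∀ k, Tendsto (fun n => h.galerkinCoeffAt (φ n) t k) atTop (𝓝 (c t k))) ∧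
      (∀ t, 0 ≤ t → ∀ F : Finset (d → ℤ), ∑ k ∈ F, ‖c t k‖ ^ 2 ≤ ∫ x, ‖w₀ x‖ ^ 2) ∧
      (∀ k s t, 0 ≤ s → 0 ≤ t → ‖c t k - c s k‖ ≤ pvsModeLip 𝔸 M w₀ k * |t - s|) ∧
      (∀ t, 0 ≤ t → IsConjSymm (c t)) ∧
      (∀ t, 0 ≤ t → ∀ k, ∑ j, (k j : ℂ) * c t k j = 0) := by
  classical
  have hM := h.carrier.nonneg
  -- Step 1: the diagonal subsequence at nonnegative rational times
  set ι := (d → ℤ) × {q : ℚ // (0 : ℝ) ≤ q} with hι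
  set x : ℕ → ι → EuclideanSpace ℂ d := fun N p => h.galerkinCoeffAt N ((p.2 : ℚ) : ℝ) p.1 with hx
  have hxb : ∀ p : ι, ∃ (z : EuclideanSpace ℂ d) (R : ℝ), ∀ N, x N p ∈ closedBall z R := fun p =>
    ⟨0, Real.sqrt (∫ x, ‖w₀ x‖ ^ 2), fun N => by
      rw [mem_closedBall, dist_zero_right]
      exact h.norm_galerkinCoeffAt_le N p.2.2 p.1⟩
  obtain ⟨φ, hφ, hlimq⟩ := exists_strictMono_forall_tendsto x hxb
  -- Step 2: convergence at every `t ≥ 0`, frequency by frequency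
  have hall : ∀ k, ∀ t ∈ Ici (0 : ℝ), ∃ l, Tendsto (fun n => h.galerkinCoeffAt (φ n) t k) atTop (𝓝 l) := by
    intro k
    refine forall_exists_tendsto_of_subset_closure (x := fun n t => h.galerkinCoeffAt (φ n) t k)
      Ici_subset_closure_nonneg_rat ?_ ?_
    · rintro _ ⟨q, hq, rfl⟩
      exact hlimq (k, ⟨q, hq⟩)
    · intro ε hε
      have hL : 0 ≤ pvsModeLip 𝔸 M w₀ k := pvsModeLip_nonneg 𝔸 hM w₀ k
      refine ⟨ε / (pvsModeLip 𝔸 M w₀ k + 1), by positivity, fun n t ht s hs hts => ?_⟩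
      obtain ⟨q, hq, rfl⟩ := hs
      rw [dist_eq_norm]
      have hmax_t : t ∈ Icc 0 (max t q) := ⟨ht, le_max_left _ _⟩
      have hmax_q : (q : ℝ) ∈ Icc 0 (max t q) := ⟨hq, le_max_right _ _⟩
      by_cases hkS : k ∈ freqBall (φ n)
      · calc ‖h.galerkinCoeffAt (φ n) t k - h.galerkinCoeffAt (φ n) q k‖
            ≤ pvsModeLip 𝔸 M w₀ k * |t - q| := by
              rw [PVSSetup.galerkinCoeffAt, PVSSetup.galerkinCoeffAt, coeffExt_of_mem _ hkS, coeffExt_of_mem _ hkS]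
              exact h.norm_galerkinCoeff_sub_le (φ n) hmax_q hmax_t ⟨k, hkS⟩
          _ < pvsModeLip 𝔸 M w₀ k * (ε / (pvsModeLip 𝔸 M w₀ k + 1)) + 1 * (ε / (pvsModeLip 𝔸 M w₀ k + 1)) := by
              have h1 : |t - q| < ε / (pvsModeLip 𝔸 M w₀ k + 1) := by rwa [← Real.dist_eq]
              nlinarith [mul_le_mul_of_nonneg_left h1.le hL, abs_nonneg (t - (q : ℝ))]
          _ = ε := by field_simp
      · rw [PVSSetup.galerkinCoeffAt, PVSSetup.galerkinCoeffAt, coeffExt_of_not_mem _ hkS, coeffExt_of_not_mem _ hkS,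
          sub_zero, norm_zero]
        exact hε
  -- Step 3: the limits and their properties
  choose! c hc using hall
  refine ⟨φ, hφ, fun t k => c k t, fun t ht k => hc k t ht, ?_, ?_, ?_, ?_⟩
  · intro t ht F
    have hF : Tendsto (fun n => ∑ k ∈ F, ‖h.galerkinCoeffAt (φ n) t k‖ ^ 2) atTop
        (𝓝 (∑ k ∈ F, ‖c k t‖ ^ 2)) :=
      tendsto_finsetSum F fun k _ => ((hc k t ht).norm).pow 2
    exact le_of_tendsto hF (Eventually.of_forall fun n => h.sum_norm_sq_galerkinCoeffAt_le (φ n) ht F)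
  · intro k s t hs ht
    have hd := dist_lim_le_of_dist_le (ε := pvsModeLip 𝔸 M w₀ k * |t - s|) (hc k t ht) (hc k s hs) fun n => by
      rw [dist_eq_norm]
      by_cases hkS : k ∈ freqBall (φ n)
      · rw [PVSSetup.galerkinCoeffAt, PVSSetup.galerkinCoeffAt, coeffExt_of_mem _ hkS, coeffExt_of_mem _ hkS]
        exact h.norm_galerkinCoeff_sub_le (φ n) (T := max s t) ⟨hs, le_max_left _ _⟩ ⟨ht, le_max_right _ _⟩ ⟨k, hkS⟩
      · rw [PVSSetup.galerkinCoeffAt, PVSSetup.galerkinCoeffAt, coeffExt_of_not_mem _ hkS, coeffExt_of_not_mem _ hkS,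
          sub_zero, norm_zero]
        exact mul_nonneg (pvsModeLip_nonneg 𝔸 hM w₀ k) (abs_nonneg _)
    rwa [dist_eq_norm] at hd
  · intro t ht k
    have h1 : Tendsto (fun n => h.galerkinCoeffAt (φ n) t (-k)) atTop (𝓝 (EuclideanSpace.conjVec (c k t))) := by
      have hcont : Continuous (EuclideanSpace.conjVec (ι := d)) := (EuclideanSpace.conjVecL (ι := d)).continuous
      have h2 := (hcont.tendsto (c k t)).comp (hc k t ht)
      refine h2.congr fun n => ?_
      simp only [Function.comp_apply]
      exact ((h.isConjSymm_galerkinCoeffAt (φ n) t) k).symm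
    exact tendsto_nhds_unique (hc (-k) t ht) h1
  · intro t ht k
    have hcont : Continuous fun v : EuclideanSpace ℂ d => ∑ j, (k j : ℂ) * v j :=
      continuous_finsetSum _ fun j _ => continuous_const.mul (EuclideanSpace.proj j).continuous
    have h1 := (hcont.tendsto (c k t)).comp (hc k t ht)
    have h2 : ((fun v : EuclideanSpace ℂ d => ∑ j, (k j : ℂ) * v j) ∘ fun n => h.galerkinCoeffAt (φ n) t k) =
        fun _ => 0 := funext fun n => h.sum_mul_galerkinCoeffAt (φ n) t k
    rw [h2] at h1
    exact (tendsto_nhds_unique tendsto_const_nhds h1).symm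

end Extraction

/-! ## §4 The limit field -/

section LimitField

variable {𝔸 : Visc4 d} {lo hi : ℝ} {b : ℝ → UnitAddTorus d → EuclideanSpace ℝ d} {M G : ℝ}
  {w₀ : UnitAddTorus d → EuclideanSpace ℝ d}

/-- **A Galerkin limit** of the smooth-carrier scheme: a subsequence `φ`, coefficient limits `c` and a real field
`w` with: convergence of every mode at every `t ≥ 0`, finite energy bounds, Lipschitz modes, conjugate symmetry,
transversality, joint measurability of `w`, `w t ∈ L²` and `𝓕(complexify ∘ w t) = c t` for every `t ≥ 0`.
[cite: RobinsonRodrigoSadowski2016, Thm. 4.11] -/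
structure PVSSetup.IsGalerkinLimit (h : PVSSetup 𝔸 lo hi b M G w₀) (φ : ℕ → ℕ)
    (c : ℝ → (d → ℤ) → EuclideanSpace ℂ d) (w : ℝ → UnitAddTorus d → EuclideanSpace ℝ d) : Prop where
  strictMono : StrictMono φ
  tendsto_coeff : ∀ t, 0 ≤ t → ∀ k, Tendsto (fun n => h.galerkinCoeffAt (φ n) t k) atTop (𝓝 (c t k))
  sum_sq_le : ∀ t, 0 ≤ t → ∀ F : Finset (d → ℤ), ∑ k ∈ F, ‖c t k‖ ^ 2 ≤ ∫ x, ‖w₀ x‖ ^ 2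
  lip : ∀ k s t, 0 ≤ s → 0 ≤ t → ‖c t k - c s k‖ ≤ pvsModeLip 𝔸 M w₀ k * |t - s|
  conjSymm : ∀ t, 0 ≤ t → IsConjSymm (c t)
  transversal : ∀ t, 0 ≤ t → ∀ k, ∑ j, (k j : ℂ) * c t k j = 0
  aestronglyMeasurable : AEStronglyMeasurable (stLift w) (volume.restrict (Ioi 0 ×ˢ univ))
  memLp : ∀ t, 0 ≤ t → MemLp (w t) 2 volume
  coeff_eq : ∀ t, 0 ≤ t → ∀ k, mFourierCoeff (EuclideanSpace.complexify ∘ w t) k = c t k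

/-- **Galerkin limits exist** (diagonal extraction + parametrised Riesz–Fischer synthesis). [cite: RobinsonRodrigoSadowski2016, Thm. 4.11] -/
theorem PVSSetup.exists_isGalerkinLimit (h : PVSSetup 𝔸 lo hi b M G w₀) :
    ∃ φ c w, h.IsGalerkinLimit φ c w := by
  obtain ⟨φ, hφ, c, hconv, hsum, hlip, hsymm, htrans⟩ := h.exists_subseq_tendsto_galerkinCoeffAt
  -- hypotheses of the parametrised Riesz–Fischer theorem
  have hmeas : ∀ k, AEStronglyMeasurable (fun t => c t k) (volume.restrict (Ioi 0)) := by
    intro k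
    have hL : LipschitzOnWith (Real.toNNReal (pvsModeLip 𝔸 M w₀ k)) (fun t => c t k) (Ici 0) := by
      refine LipschitzOnWith.of_dist_le_mul fun t ht s hs => ?_
      rw [dist_eq_norm, Real.dist_eq]
      exact (hlip k s t hs ht).trans (mul_le_mul_of_nonneg_right (Real.le_coe_toNNReal _) (abs_nonneg _))
    exact (hL.continuousOn.mono Ioi_subset_Ici_self).aestronglyMeasurable measurableSet_Ioi
  have hbound : ∀ T : ℝ, ∃ K : ℝ≥0∞, K ≠ ⊤ ∧ ∀ t ∈ Icc 0 T, ∑' k, ‖c t k‖ₑ ^ 2 ≤ K := by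
    intro T
    refine ⟨ENNReal.ofReal (∫ x, ‖w₀ x‖ ^ 2), ENNReal.ofReal_ne_top, fun t ht => ?_⟩
    refine ENNReal.summable.tsum_le_of_sum_le fun F => ?_
    have h1 : ∑ k ∈ F, ‖c t k‖ₑ ^ 2 = ENNReal.ofReal (∑ k ∈ F, ‖c t k‖ ^ 2) := by
      rw [ENNReal.ofReal_sum_of_nonneg fun k _ => sq_nonneg _]
      refine Finset.sum_congr rfl fun k _ => ?_
      rw [← ofReal_norm, ENNReal.ofReal_pow (norm_nonneg _)]
    rw [h1]
    exact ENNReal.ofReal_le_ofReal (hsum t ht.1 F)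
  obtain ⟨u, hum, hu⟩ := exists_realField_forall_mFourierCoeff_eq hmeas hbound hsymm
  exact ⟨φ, c, u, ⟨hφ, hconv, hsum, hlip, hsymm, htrans, hum, fun t ht => (hu t ht).1,
    fun t ht => (hu t ht).2⟩⟩

namespace PVSSetup.IsGalerkinLimit

variable {h : PVSSetup 𝔸 lo hi b M G w₀} {φ : ℕ → ℕ} {c : ℝ → (d → ℤ) → EuclideanSpace ℂ d}
  {w : ℝ → UnitAddTorus d → EuclideanSpace ℝ d}

/-- **`L²` bound of the limit**: `∫‖w(t)‖² ≤ ∫‖w₀‖²` for `t ≥ 0` (Parseval and the finite energy bounds of the limiting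
coefficients). [cite: RobinsonRodrigoSadowski2016, Thm. 4.6] -/
theorem integral_norm_sq_le (hl : h.IsGalerkinLimit φ c w) {t : ℝ} (ht : 0 ≤ t) :
    ∫ x, ‖w t x‖ ^ 2 ≤ ∫ x, ‖w₀ x‖ ^ 2 := by
  have hP := hasSum_sq_norm_mFourierCoeff_complexify (hl.memLp t ht)
  simp_rw [hl.coeff_eq t ht] at hP
  rw [← hP.tsum_eq]
  exact hP.summable.tsum_le_of_sum_le (hl.sum_sq_le t ht)

/-- `∫‖w(t)‖² = ∑' k, ‖c t k‖²` (Parseval for the limit). [cite: Grafakos2014, Prop. 3.2.7 (3)] -/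
theorem hasSum_sq_norm (hl : h.IsGalerkinLimit φ c w) {t : ℝ} (ht : 0 ≤ t) :
    HasSum (fun k => ‖c t k‖ ^ 2) (∫ x, ‖w t x‖ ^ 2) := by
  have hP := hasSum_sq_norm_mFourierCoeff_complexify (hl.memLp t ht)
  simp_rw [hl.coeff_eq t ht] at hP
  exact hP

/-- **The slices of a Galerkin limit: weak divergence-freeness and weak convergence.** For `t ≥ 0`: the slice `w t`
is weakly divergence free (transversal coefficients), and `∫⟪g, u_{φ n}(t)⟫ → ∫⟪g, w(t)⟫` for every `g ∈ L²(T^d; ℝ^d)`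
(the differences are bounded in `L²` with all Fourier modes tending to zero). [cite: RobinsonRodrigoSadowski2016, Thm. 4.11] -/
theorem slice_props (hl : h.IsGalerkinLimit φ c w) {t : ℝ} (ht : 0 ≤ t) :
    FunctionSpaces.Torus.IsWeaklyDivFree (w t) ∧
      ∀ g : UnitAddTorus d → EuclideanSpace ℝ d, MemLp g 2 volume →
        Tendsto (fun n => ∫ x, ⟪g x, h.galerkinApprox (φ n) t x⟫_ℝ) atTop (𝓝 (∫ x, ⟪g x, w t x⟫_ℝ)) := by
  refine ⟨Torus.isWeaklyDivFree_of_sum_mul_mFourierCoeff_eq_zero (hl.memLp t ht) fun k => by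
    rw [hl.coeff_eq t ht k]; exact hl.transversal t ht k, fun g hg => ?_⟩
  have hW : ∀ n, MemLp (h.galerkinApprox (φ n) t) 2 volume := fun n => memLp_realTrigPoly _ _ 2
  have hw := hl.memLp t ht
  have hE : ∀ n, ∫ x, ‖h.galerkinApprox (φ n) t x‖ ^ 2 ≤ ∫ x, ‖w₀ x‖ ^ 2 := fun n =>
    h.integral_norm_sq_galerkinApprox_le (φ n) ht
  have hEw : ∫ x, ‖w t x‖ ^ 2 ≤ ∫ x, ‖w₀ x‖ ^ 2 := hl.integral_norm_sq_le ht
  have hcoef : ∀ k, Tendsto (fun n => mFourierCoeff (EuclideanSpace.complexify ∘ h.galerkinApprox (φ n) t) k) atTop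
      (𝓝 (mFourierCoeff (EuclideanSpace.complexify ∘ w t) k)) := by
    intro k
    rw [hl.coeff_eq t ht k]
    simp_rw [h.mFourierCoeff_galerkinApprox]
    exact hl.tendsto_coeff t ht k
  exact Torus.tendsto_integral_inner_of_tendsto_mFourierCoeff hW hw hg hE hEw hcoef

/-- The limiting modes are continuous on `[0, ∞)`. [cite: RobinsonRodrigoSadowski2016, Thm. 4.11] -/
theorem continuousOn_coeff (hl : h.IsGalerkinLimit φ c w) (k : d → ℤ) : ContinuousOn (fun t => c t k) (Ici 0) := by
  have hL : LipschitzOnWith (Real.toNNReal (pvsModeLip 𝔸 M w₀ k)) (fun t => c t k) (Ici 0) := by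
    refine LipschitzOnWith.of_dist_le_mul fun t ht s hs => ?_
    rw [dist_eq_norm, Real.dist_eq]
    exact (hl.lip k s t hs ht).trans (mul_le_mul_of_nonneg_right (Real.le_coe_toNNReal _) (abs_nonneg _))
  exact hL.continuousOn

end PVSSetup.IsGalerkinLimit

end LimitField

end Torus

end Literature.Analysis.FluidPDE
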